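import Summits.BirchSwinnertonDyer.BirchSwinnertonDyer.Theorems.ClassRecordThreeEulerHalvesAtThreeWalkSupplyAtThreeSelmer
import Summits.BirchSwinnertonDyer.BirchSwinnertonDyer.Theorems.ClassRecordThreeEulerHalvesAtThreeWalkSupplyAtThreeGross1991
import Summits.BirchSwinnertonDyer.Rank1Residual.JET.GrossProp53Kolyvagin
import Literature.NumberTheory.EllipticCurves.HeegnerPointsOfConductorOneGaloisConjProofs
import Literature.NumberTheory.EllipticCurves.HeegnerPointsOfConductorOneRationalityProofs
import Literature.NumberTheory.QuadraticFields.HeegnerCondition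
import HarnessLib

/-!
# `stub_jetchevMaxHLAtThree` (Jetchev 2008 Thm. 1.4 in MAX form at `3 ∥ N`; the registered Euler-system
# input of item 19109 `EulerHalvesAtThree`) MODULO SIX NAMED LITERATURE FACTS — McCallum Prop. 5.2,
# McCallum Prop. 4.4, Gross–Zagier, modularity, Poitou–Tate, Gross 1991 §6 ∕ [GZ86 III (3.1)] — every
# one a published theorem typed statement-first in `Literature/`; NO schema, NO Summits-side `def`
# hypothesis, NO kernel gap, NO core-vertex binder (cell `bsd-stepL`, seat `bsd-stepL-tam3-p1` g8, helper
# toward item 19109)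

HONEST FRAMING. Nothing here proves BSD, J₃ or the divisibility of any Heegner point of any curve; the
registered stub `stub_jetchevMaxHLAtThree` is proved MODULO six NAMED PRINT hypotheses — a CONDITIONAL
result (D-0014), not a discharge; no item closes; 0 classes move (T7);
`--supports stmt-BirchSwinnertonDyer-19109` (helper).

WHAT THIS FILE DOES. `jetchevMaxHLAtThree_of_facts_of_print : h52 → h44 → hGZ → hmod → hPT → hF1 →
‹stub VERBATIM›`. Versus the display of record p541099 (`…_of_facts_of_namedPrint`, NINE hypotheses):
* `hD36` (Darmon Thm. 3.6 at conductor 1) := `phi_heegnerTau_mem_singularModuliField_holds` (Literature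
  THEOREM); `hrec` (Gross §4 ∕ Darmon Thm. 3.7 for `y(1)`) := `heegnerPointOfConductor_one_galoisConj_holds`
  (Literature THEOREM) — both were carried as hypotheses although PROVED in the tree;
* `h53` (Gross 1991 Prop. 5.3, `τ y_m = ε σ' y_m + torsion`; the Summits-side named `def`
  `heegnerPointOfConductor_conj_sub_neg_rootNumber_smul` of `…WalkGross53`) is GONE: at the admissible
  conductors where the walk consumes it, it is bsd-jet reader 1's THEOREM
  `JET.exists_mem_ringClassGal_isOfFinAddOrder_conj_sub_smul` (p507418 + x11b3 `KolyvaginA53.h53_of_recM`);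
* `hGZ31` (the [GZ86 III (3.1)] receptacle SCHEMA, universal in the conductor, satisfiability
  unverified) is REPLACED by the Literature FACT `hF1 : Gross1991_heegnerPoint_sub_ratTorsion_mem_E0`
  through `selmerSupplyAtThree_of_poitouTate_Gross1991` (`…WalkSupplyAtThreeGross1991`).
The proof is p517133's (`…_of_facts_of_selmerSupply`) with those three substitutions, byte for byte
otherwise. WHAT IS LEFT (all cite-only named facts of `Literature/`, each an `X : Prop` with a locator):
`McCallum1991.prop52_exists_conductor_kolyvaginClass_order_eq` ([McC] Prop. 5.2, Chebotarev),
`McCallum1991.prop44_localOrder_kolyvaginClass_mul_eq` ([McC] Prop. 4.4), `gross_zagier` ([GZ86] I (6.3)),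
`hasEntireLFunction_rat` (modularity), `poitouTate_selmerStructure_duality_conj` (Milne ADT I 4.10 ∕
Howard 2.1.11), `Gross1991_heegnerPoint_sub_ratTorsion_mem_E0` (Gross 1991 §6 ∕ [GZ86 III (3.1)]).
References (locators only; no cited FACT is declared): [cite: Jetchev2008, Thm. 1.4 (p. 812), §3–§6,
Proof of Thm. 1.4 (p. 825)] [cite: McCallumLMS1991, §4 Prop. 4.4, §5 Prop. 5.2] [cite: GrossLMS1991, §3,
§5 Prop. 5.3, §6 Prop. 6.2 (1)] [cite: GrossZagier1986, I (6.3), III (3.1)] [cite: Darmon2004, Thm. 3.6,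
Thm. 3.7, Prop. 3.11] [cite: Howard2004HeegnerKolyvagin, Prop. 2.1.7, 2.1.9, Thm. 2.1.11, Lemma 2.7.3]
[cite: MilneADT2006, Ch. I, Thm. 4.10(b)]. Design: one theorem, no definitions; `K : Type`. Axioms:
`propext`, `Classical.choice`, `Quot.sound`.
-/

set_option autoImplicit false

noncomputable section

open scoped Classical NumberField

namespace Summit.BirchSwinnertonDyer.Rank1Residual.X11b.Three.Koly

open WeierstrassCurve IsDedekindDomain NumberField Field Literature.NumberTheory.EllipticCurves
  Literature.NumberTheory.EllipticCurves.ModularForms Literature.NumberTheory.EllipticCurves.Jetchev2008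
  Literature.NumberTheory.EllipticCurves.KolyvaginCocycle
  Literature.NumberTheory.EllipticCurves.Rank1Residual Literature.NumberTheory.GaloisRepresentations
  Literature.NumberTheory.GaloisRepresentations.DiscreteGaloisModule
  Literature.NumberTheory.GaloisCohomology Literature.NumberTheory.Automorphic
  Summit.BirchSwinnertonDyer.Rank1Residual.X11b Summit.BirchSwinnertonDyer.Rank1Residual.JET

/-- **`stub_jetchevMaxHLAtThree` VERBATIM modulo SIX named Literature facts** (McCallum Prop. 5.2 and
Prop. 4.4, Gross–Zagier, modularity, Poitou–Tate for Selmer structures, Gross 1991 §6 ∕ [GZ86 III (3.1)]);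
CONDITIONAL, nothing asserted about any curve; see the module docstring.
[cite: Jetchev2008, Thm. 1.4 (p. 812), Proof of Thm. 1.4 (p. 825)] [cite: McCallumLMS1991, §4 Prop. 4.4,
§5 Prop. 5.2] [cite: GrossLMS1991, §5 Prop. 5.3, §6 Prop. 6.2 (1)] [cite: GrossZagier1986, III (3.1)] -/
theorem jetchevMaxHLAtThree_of_facts_of_print
    -- NAMED LITERATURE FACTS (cite-only)
    (h52 : McCallum1991.prop52_exists_conductor_kolyvaginClass_order_eq)
    (h44 : McCallum1991.prop44_localOrder_kolyvaginClass_mul_eq)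
    (hGZ : ∀ (N : ℕ) [NeZero N] (W : WeierstrassCurve ℚ) (K : Type) [Field K] [NumberField K],
      gross_zagier N W K)
    (hmod : hasEntireLFunction_rat)
    (hPT : ∀ (K : Type) [Field K] [NumberField K], poitouTate_selmerStructure_duality_conj K)
    (hF1 : Gross1991_heegnerPoint_sub_ratTorsion_mem_E0) :
    ∀ (W : WeierstrassCurve ℚ) [W.IsElliptic] [W.IsGloballyMinimal] [NeZero (W.conductorNorm ℤ)]
      (K : Type) [Field K] [NumberField K]
      (Dt : ModularParametrizationData W (W.conductorNorm ℤ)) (β : ℤ) (ι : K →+* ℂ),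
      W.analyticRank = 1 → W.HasMultiplicativeReductionAtPrime 3 → Surj W 3 →
      IsImaginaryQuadratic K → SatisfiesHeegnerHypothesis (W.conductorNorm ℤ) K →
      Odd (NumberField.discr K) → (W.quadraticTwist (NumberField.discr K : ℚ)).entireLFunction 1 ≠ 0 →
      (4 * (W.conductorNorm ℤ : ℤ)) ∣ β ^ 2 - NumberField.discr K → ¬ (3 : ℤ) ∣ Dt.c →
      ∀ (v : HeightOneSpectrum (𝓞 ℚ)) (s : ℕ), s ≤ padicValNat 3 (W.tamagawaNumberAt v) →
        ∀ (n : ℕ) (d : KolyvaginHeegnerData Dt β ι n), Squarefree n →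
          (∀ ℓ ∈ n.primeFactors, Zhang2014.IsKolyvaginPrime (W.conductorNorm ℤ) W K 3 ℓ ∧
            s ≤ Zhang2014.kolyvaginIndex W 3 ℓ) → PDiv d 3 s := by
  refine jetchevMaxHLAtThree_of_facts_of_perLevel h52
    (fun N _ W K _ _ ↦ phi_heegnerTau_mem_singularModuliField_holds N W K)
    (fun N _ W K _ _ ↦ heegnerPointOfConductor_one_galoisConj_holds N W K) hGZ hmod ?_
  intro W _ _ _ K _ _ Dt β ι hr hmult hρ hK hHN hodd hLt hβ hc3 v k n d hsq hkol h1 h2 h3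
  -- `k ≥ 1` and the admissibility of `n` at level `k`
  have hk : 1 ≤ k := by
    rcases Nat.eq_zero_or_pos k with rfl | hk
    · exact absurd h1 (by simp)
    · exact hk
  have hkM : (k : ℕ∞) ≤ Zhang2014.levelIndex W 3 n := le_trans le_self_add h3
  have hn : Squarefree n ∧ ∀ q ∈ n.primeFactors,
      Zhang2014.IsKolyvaginPrime (W.conductorNorm ℤ) W K 3 q ∧ k ≤ Zhang2014.kolyvaginIndex W 3 q :=
    ⟨hsq, fun q hq ↦ ⟨hkol q hq, Zhang2014.natCast_le_levelIndex_iff.mp hkM q hq⟩⟩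
  -- frame facts: complex conjugation, `(N, d_K) = 1`, `d_K < -4`
  obtain ⟨τ, hτ⟩ := exists_algEquiv_ne_one_of_isImaginaryQuadratic K hK
  have hND : IsCoprime ((W.conductorNorm ℤ : ℕ) : ℤ) (NumberField.discr K) :=
    KolyvaginAssembly.isCoprime_discr_of_satisfiesHeegnerHypothesis hK hHN
  have hD : NumberField.discr K < -4 := by
    have hneg : NumberField.discr K < 0 := hK.discr_neg
    have h3split : SatisfiesHeegnerHypothesis 3 K :=
      SatisfiesHeegnerHypothesis.of_dvd (dvd_conductorNorm_of_mult (W := W) hmult) hHN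
    have hpd : ¬ ((3 : ℕ) : ℤ) ∣ NumberField.discr K :=
      not_dvd_discr_of_split hK Nat.prime_three (by norm_num) h3split
    have hD3 : NumberField.discr K ≠ -3 := fun h ↦ hpd (h ▸ ⟨-1, by norm_num⟩)
    have h4 : NumberField.discr K % 4 = 0 ∨ NumberField.discr K % 4 = 1 :=
      Literature.NumberTheory.QuadraticFields.Quadratic.discr_emod_four (K := K) hK.1
    obtain ⟨r, hr⟩ := hodd
    omega
  -- Gross's one system of choices extending `d`, and Prop. 4.7 for it (from `h44`)
  have hcm : ¬ W.HasCM := not_hasCM_of_hasMultiplicativeReductionAtPrime' W hmult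
  have htower : ∀ j : ℕ, W.HasSurjectiveModNGaloisRep (3 ^ j : ℕ) :=
    forall_hasSurjectiveModNGaloisRep_pow_of_multiplicative_of_surj W 3 (by norm_num) hmult hρ
  obtain ⟨D, hDd, h47⟩ := exists_data_h47Base_of_prop44 h44 W hcm hK hD hHN (p := 3) (by norm_num) htower
    Dt β ι hk hn d
  -- the sign `ε := −w(E)`, a sign function for it, and Gross Prop. 5.3 for the data — UNCONDITIONAL
  -- (bsd-jet reader 1's `JET.exists_mem_ringClassGal_isOfFinAddOrder_conj_sub_smul`: Shimura reciprocity
  -- at conductor `m` + x11b3's `KolyvaginA53.h53_of_recM`; admissible conductors are `≠ 0`, prime to `N`)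
  have hε : (-W.rootNumber : ℤ) = 1 ∨ (-W.rootNumber : ℤ) = -1 := by
    rcases W.rootNumber_eq_one_or with h | h <;> simp [h]
  obtain ⟨eb, heb, hebε⟩ := Walk.exists_signFunction (-W.rootNumber) hε
  have h53D : ∀ (s s' : {m : ℕ // Squarefree m ∧ ∀ q ∈ m.primeFactors,
        Zhang2014.IsKolyvaginPrime (W.conductorNorm ℤ) W K 3 q ∧ k ≤ Zhang2014.kolyvaginIndex W 3 q})
      (_ : s'.1 ∣ s.1) (τm : ringClassField K ι s'.1 ≃ₐ[ℚ] ringClassField K ι s'.1),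
      (∀ x : ringClassField K ι s'.1, ((τm x : ringClassField K ι s'.1) : ℂ) = starRingEnd ℂ x) →
      ∃ σ' ∈ ringClassGal ι s'.1, IsOfFinAddOrder
        (pointGalHom W (ringClassField K ι s'.1) τm (D s').y -
          (-W.rootNumber) • pointGalHom W (ringClassField K ι s'.1) σ' (D s').y) := by
    intro s s' _ τm hτm
    obtain ⟨hm0, hmN⟩ := ne_zero_and_coprime_of_isKolyvaginPrime (K := K) s'.2.1
      (fun q hq ↦ (s'.2.2 q hq).1)
    exact exists_mem_ringClassGal_isOfFinAddOrder_conj_sub_smul W hK hHN Dt ι hm0 hmN (D s') τm hτm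
  -- the supply at this frame, for these data and signs
  obtain ⟨𝒯, 𝒮, Qcar, C', hS, hQcar, hdisj, hPT, hselmer, hC, hdual_q, hsel0, hdual_ℓ⟩ :=
    selmerSupplyAtThree_of_poitouTate_Gross1991 hPT hF1 W K Dt β ι hr hmult hρ hK hHN hodd hLt hβ hc3 τ hτ
      v k hk h2 n d hn D hDd (-W.rootNumber) hε eb heb hebε
  have h49 := h49_of_selmerMembership W hK hND hD (p := 3) (by norm_num) hρ Dt β ι hτ hk 𝒯 𝒮 Qcar D eb
    (-W.rootNumber) hebε h53D n hsel0
  have hordκ := hordκ_of_admissibleData W hK hND hD (p := 3) (by norm_num) hρ Dt β ι k D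
  have hdivfin := fun s ↦ divOrd_ne_top_of_levelIndex_eq_top W K
    (heegnerPointOfConductor_one_galoisConj_holds _ W K) (hGZ _ W K) hmod Dt β ι hr hK hHN hLt s (D s)
  have hfin := JET.Walk.hfin_of_kummer (K := K) W Nat.prime_three k 𝒯
  have hκt := hκt_of_selmerMembership W hK hND hD (p := 3) (by norm_num) hρ Dt β ι hτ hk 𝒯 D eb
    (-W.rootNumber) hebε h53D hdivfin hselmer
  have key := tamagawaExponent_le_m_of_orderedFamiliesBase W K hK 3 (by decide) hρ Dt β ι τ hτ k
    (padicValNat 3 (W.tamagawaNumberAt v)) hk h2 𝒯 𝒮 hS Qcar hQcar D eb heb n hn ?_ ?_ hdisj hfin hPT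
    (fun s _ ↦ hκt s) hordκ h47 C' hC hdual_q h49 hdual_ℓ
  · rw [hDd] at key
    exact key
  · rw [hDd]; exact h1
  · rw [hDd]; exact h3

end Summit.BirchSwinnertonDyer.Rank1Residual.X11b.Three.Koly

end
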